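import Summits.CriticalPhenomena.PercolationContinuityZ3.Theorems.PercNearOneGluingNoHeavyLowerTailSahiOneStepUniformMonoAPrelim
import Summits.CriticalPhenomena.PercolationContinuityZ3.Theorems.PercNearOneGluingNoHeavyLowerTailSahiOneStepUniformMonoB
import HarnessLib

/-!
# One-step scheme, `(2′)` half at uniform density — MONO-A: the drift of an `e`-dominant event is nonnegative

Support file (prover prim-ineq-prove-3 gen 21; `--supports stmt-CriticalPhenomena-4575`; memo
`run/shared/lean/prim/prim-ineq-prove-3/PROOF-2PRIME-UNIFORM.md`, Lemma 6 and tool (T4)).  No definitions, no named facts, no sorries, no `native_decide`.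

Block `insert e F` (`e ∉ F`), slot `H = {ω | t+1 ≤ #(insert e F ∩ ω)}`, `t ≤ #F`, a product measure whose densities on `F` lie in `(0,1)`, and an
increasing `insert e F`-determined event `A` which is **`e`-dominant**: `ω ∈ A`, `e ∉ ω`, `j ∈ F ∩ ω` ⟹ `(ω ∖ {j}) ∪ {e} ∈ A` (the coordinate `e` beats
every coordinate of `F`; e.g. `A` left-shifted with `e` leftmost).  Then (memo Lemma 6) every one-point deletion inside `F` of a member of the outer
section `A⁰` lies in the inner section `A¹`, so by the shadow inequality `real_shadow_layer_mul_le` the density of `A¹` at level `k` dominates the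
density of `A⁰` at level `k+1`; with the layer monotonicity of `A⁰` and the log-concavity of the layer law (`real_layer_logConcave`) the MLR comparison
lemma `sum_mul_sum_le_of_mlr` (tool (T4)) gives
`μ{N_F ≤ t}·μ(A¹ ∩ {N_F < t}) ≥ μ{N_F < t}·μ(A⁰ ∩ {N_F ≤ t})`, i.e. the ball-conditioned drift `U_A` of the cross-form step lemma is `≥ 0`
(`drift_nonneg_of_dominant`, the hypothesis `hUA`).
-/

noncomputable section

namespace Summit.CriticalPhenomena.PercolationContinuityZ3.Theorems

namespace SahiOneStep

open MeasureTheory Finset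
open Literature.Probability.Percolation (DeterminedBy determinedBy_iff)
open Literature.Probability.LatticeModels (prodBernoulli)
open Literature.Probability.Percolation.DecisionTree (ind ind_of_mem ind_of_not_mem wtW wtW_nonneg)
open SahiE3Sections (determinedBy_section_insert determinedBy_section_sdiff)
open scoped Classical

variable {ι : Type*} [Fintype ι]

/-! ## Tool (T4): the MLR comparison of two averages of a monotone sequence -/

omit [Fintype ι] in
/-- **MLR comparison** (tool (T4)): for weights `u, v` on `{0,…,n−1}` with `u_k v_j ≤ u_j v_k` whenever `k < j` (the likelihood ratio
`u/v` is nondecreasing) and a nondecreasing `g`, the `u`-average of `g` dominates its `v`-average: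
`(Σ v_j g_j)(Σ u_k) ≤ (Σ u_j g_j)(Σ v_k)`.  [folklore] -/
theorem sum_mul_sum_le_of_mlr (n : ℕ) (u v g : ℕ → ℝ)
    (hmlr : ∀ j k, j < n → k < j → u k * v j ≤ u j * v k) (hg : ∀ j k, j < n → k ≤ j → g k ≤ g j) :
    (∑ j ∈ range n, v j * g j) * (∑ k ∈ range n, u k) ≤ (∑ j ∈ range n, u j * g j) * (∑ k ∈ range n, v k) := by
  rw [Finset.sum_mul_sum, Finset.sum_mul_sum, ← sub_nonneg, ← Finset.sum_sub_distrib]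
  simp_rw [← Finset.sum_sub_distrib]
  -- `M j k = g_j (u_j v_k − v_j u_k)`; symmetrise
  set M : ℕ → ℕ → ℝ := fun j k => u j * g j * v k - v j * g j * u k with hM
  have hsym : ∑ j ∈ range n, ∑ k ∈ range n, M j k = ∑ j ∈ range n, ∑ k ∈ range n, M k j := Finset.sum_comm
  have hpair : ∀ j ∈ range n, ∀ k ∈ range n, 0 ≤ M j k + M k j := by
    intro j hj k hk
    rw [Finset.mem_range] at hj hk
    have e : M j k + M k j = (g j - g k) * (u j * v k - u k * v j) := by rw [hM]; ring
    rw [e]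
    rcases lt_trichotomy k j with hkj | rfl | hjk
    · exact mul_nonneg (sub_nonneg.2 (hg j k hj hkj.le)) (sub_nonneg.2 (hmlr j k hj hkj))
    · simp
    · have h1 : g j - g k ≤ 0 := sub_nonpos.2 (hg k j hk hjk.le)
      have h2 : u j * v k - u k * v j ≤ 0 := sub_nonpos.2 (hmlr k j hk hjk)
      exact mul_nonneg_of_nonpos_of_nonpos h1 h2
  have h2 : (∑ j ∈ range n, ∑ k ∈ range n, M j k) + (∑ j ∈ range n, ∑ k ∈ range n, M k j) =
      ∑ j ∈ range n, ∑ k ∈ range n, (M j k + M k j) := by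
    rw [← Finset.sum_add_distrib]
    refine Finset.sum_congr rfl fun j _ => ?_
    rw [← Finset.sum_add_distrib]
  have hnn : 0 ≤ ∑ j ∈ range n, ∑ k ∈ range n, (M j k + M k j) :=
    Finset.sum_nonneg fun j hj => Finset.sum_nonneg fun k hk => hpair j hj k hk
  have : 0 ≤ ∑ j ∈ range n, ∑ k ∈ range n, M j k := by linarith
  simpa [hM] using this

/-! ## Positivity of the layers and the ball decomposition -/

omit [Fintype ι] in
/-- Every layer `{N_F = k}`, `k ≤ #F`, has positive probability when the densities on `F` lie in `(0,1)`. [folklore] -/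
theorem real_layer_pos (p : ι → unitInterval) (F : Finset ι) (hp : ∀ i ∈ F, 0 < (p i : ℝ) ∧ (p i : ℝ) < 1) {k : ℕ} (hk : k ≤ F.card) :
    0 < (prodBernoulli p).real {ω : Set ι | (F.filter (· ∈ ω)).card = k} := by
  obtain ⟨S, hSF, hSk⟩ := Finset.exists_subset_card_eq hk
  rw [real_eq_sum_wtW_ind p (determinedBy_layer F k)]
  have hterm : ∀ T ∈ F.powerset, 0 ≤ wtW F (fun i => (p i : ℝ)) T * ind (pat {ω : Set ι | (F.filter (· ∈ ω)).card = k}) T :=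
    fun T _ => mul_nonneg (wtW_nonneg F (fun i => (p i).2.1) (fun i => (p i).2.2) T) (by
      unfold ind; split_ifs <;> norm_num)
  refine lt_of_lt_of_le ?_ (Finset.single_le_sum hterm (Finset.mem_powerset.2 hSF))
  rw [ind_pat_layer F k hSF, if_pos hSk, mul_one, Literature.Probability.Percolation.DecisionTree.wtW_eq_prod_mul_prod F _ hSF]
  refine mul_pos (Finset.prod_pos fun i hi => (hp i (hSF hi)).1) (Finset.prod_pos fun i hi => ?_)
  exact sub_pos.2 (hp i (Finset.mem_sdiff.1 hi).1).2

/-- The measure of `X ∩ {N_F < s}` is the sum of the measures of `X ∩ {N_F = j}`, `j < s`. [folklore] -/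
theorem real_inter_ball_eq_sum (p : ι → unitInterval) (F : Finset ι) (X : Set (Set ι)) (s : ℕ) :
    (prodBernoulli p).real (X ∩ {ω : Set ι | (F.filter (· ∈ ω)).card < s}) =
      ∑ j ∈ range s, (prodBernoulli p).real (X ∩ {ω : Set ι | (F.filter (· ∈ ω)).card = j}) := by
  induction s with
  | zero =>
    have h0 : {ω : Set ι | (F.filter (· ∈ ω)).card < 0} = ∅ := by
      ext ω; simp only [Set.mem_setOf_eq, Set.mem_empty_iff_false, iff_false]; omega
    rw [h0, Set.inter_empty, measureReal_empty, Finset.sum_range_zero]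
  | succ s ih => rw [real_inter_ball_succ, ih, Finset.sum_range_succ]

/-- The measure of `{N_F < s}` is the sum of the layer probabilities `j < s`. [folklore] -/
theorem real_ball_eq_sum (p : ι → unitInterval) (F : Finset ι) (s : ℕ) :
    (prodBernoulli p).real {ω : Set ι | (F.filter (· ∈ ω)).card < s} =
      ∑ j ∈ range s, (prodBernoulli p).real {ω : Set ι | (F.filter (· ∈ ω)).card = j} := by
  have h := real_inter_ball_eq_sum p F Set.univ s
  simp only [Set.univ_inter] at h
  exact h

/-! ## MONO-A -/

omit [Fintype ι] in
/-- For an `e`-dominant `A` (`e ∉ F`), every one-point deletion inside `F` of a member of the outer section `A⁰ = {ω | ω ∖ {e} ∈ A}` lies in the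
inner section `A¹ = {ω | insert e ω ∈ A}` (memo Lemma 6 (i): `∂⁻A⁰ ⊆ A¹`). [this work] -/
theorem section_erase_mem_of_dominant {F : Finset ι} {e : ι} (heF : e ∉ F) {A : Set (Set ι)}
    (hdom : ∀ ω ∈ A, e ∉ ω → ∀ j ∈ F, j ∈ ω → (ω \ {j}) ∪ {e} ∈ A) :
    ∀ ω ∈ {ω : Set ι | ω \ {e} ∈ A}, ∀ j ∈ F, j ∈ ω → ω \ {j} ∈ {ω : Set ι | insert e ω ∈ A} := by
  intro ω hω j hjF hjω
  have hje : j ≠ e := fun h => heF (h ▸ hjF)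
  have h := hdom (ω \ {e}) hω (fun h => h.2 rfl) j hjF ⟨hjω, hje⟩
  have heq : (ω \ {e}) \ {j} ∪ {e} = insert e (ω \ {j}) := by
    ext x
    simp only [Set.mem_union, Set.mem_sdiff, Set.mem_singleton_iff, Set.mem_insert_iff]
    tauto
  rw [Set.mem_setOf_eq, ← heq]
  exact h

/-- **MONO-A** (memo Lemma 6): for the threshold slot `H = {t+1 ≤ #(insert e F ∩ ω)}` (`e ∉ F`, `t ≤ #F`), densities in `(0,1)` on `F`, and an
increasing `insert e F`-determined `e`-dominant event `A`, the ball-conditioned drift `U_A` of the cross-form step lemma is `≥ 0`. [this work] -/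
theorem drift_nonneg_of_dominant (p : ι → unitInterval) {F : Finset ι} {e : ι} (heF : e ∉ F) {t : ℕ} (ht : t ≤ F.card)
    (hp : ∀ i ∈ F, 0 < (p i : ℝ) ∧ (p i : ℝ) < 1) {A : Set (Set ι)}
    (hA : IsUpperSet A) (hAF : DeterminedBy A (↑(insert e F) : Set ι))
    (hdom : ∀ ω ∈ A, e ∉ ω → ∀ j ∈ F, j ∈ ω → (ω \ {j}) ∪ {e} ∈ A) :
    0 ≤ (1 - (prodBernoulli p).real {ω : Set ι | ω \ {e} ∈ {ω : Set ι | t + 1 ≤ ((insert e F).filter (· ∈ ω)).card}}) *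
          ((prodBernoulli p).real {ω : Set ι | insert e ω ∈ A} -
            (prodBernoulli p).real ({ω : Set ι | insert e ω ∈ {ω : Set ι | t + 1 ≤ ((insert e F).filter (· ∈ ω)).card}} ∩
              {ω : Set ι | insert e ω ∈ A}))
        - (1 - (prodBernoulli p).real {ω : Set ι | insert e ω ∈ {ω : Set ι | t + 1 ≤ ((insert e F).filter (· ∈ ω)).card}}) *
          ((prodBernoulli p).real {ω : Set ι | ω \ {e} ∈ A} -
            (prodBernoulli p).real ({ω : Set ι | ω \ {e} ∈ {ω : Set ι | t + 1 ≤ ((insert e F).filter (· ∈ ω)).card}} ∩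
              {ω : Set ι | ω \ {e} ∈ A})) := by
  rw [section_insert_threshold heF, section_sdiff_threshold heF, one_sub_real_threshold, one_sub_real_threshold,
    real_sub_real_threshold_inter, real_sub_real_threshold_inter]
  -- the two sections as `F`-determined increasing events
  have hcoe : (↑(insert e F) : Set ι) \ {e} = ↑F := by
    ext i
    simp only [Set.mem_sdiff, Finset.coe_insert, Set.mem_insert_iff, Finset.mem_coe, Set.mem_singleton_iff]
    constructor
    · rintro ⟨h | h, hne⟩
      · exact absurd h hne
      · exact h
    · intro h
      exact ⟨Or.inr h, fun hie => heF (hie ▸ h)⟩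
  have hA1F : DeterminedBy {ω : Set ι | insert e ω ∈ A} (↑F : Set ι) := hcoe ▸ determinedBy_section_insert hAF e
  have hA0F : DeterminedBy {ω : Set ι | ω \ {e} ∈ A} (↑F : Set ι) := hcoe ▸ determinedBy_section_sdiff hAF e
  have hA0 : IsUpperSet {ω : Set ι | ω \ {e} ∈ A} := isUpperSet_section_sdiff hA e
  have hdel := section_erase_mem_of_dominant heF hdom
  -- abbreviations
  set x : ℕ → ℝ := fun j => (prodBernoulli p).real ({ω : Set ι | ω \ {e} ∈ A} ∩ {ω : Set ι | (F.filter (· ∈ ω)).card = j}) with hx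
  set y : ℕ → ℝ := fun j => (prodBernoulli p).real ({ω : Set ι | insert e ω ∈ A} ∩ {ω : Set ι | (F.filter (· ∈ ω)).card = j}) with hy
  set π : ℕ → ℝ := fun j => (prodBernoulli p).real {ω : Set ι | (F.filter (· ∈ ω)).card = j} with hπ
  have hπpos : ∀ j, j ≤ t → 0 < π j := fun j hj => real_layer_pos p F hp (hj.trans ht)
  have hπnn : ∀ j, 0 ≤ π j := fun j => measureReal_nonneg
  -- (S): `x_{k+1} π_k ≤ y_k π_{k+1}`
  have hS : ∀ k, x (k + 1) * π k ≤ y k * π (k + 1) := fun k => real_shadow_layer_mul_le p F hA0F hA1F hdel k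
  -- (M): layer monotonicity of `A⁰`
  have hMx : ∀ j k, k ≤ j → x k * π j ≤ x j * π k := fun j k hkj => real_inter_layer_mul_le p F hA0 hA0F hkj
  -- rewrite the four measures as layer sums
  rw [real_inter_ball_eq_sum, real_inter_ball_eq_sum, real_ball_eq_sum, real_ball_eq_sum]
  -- the weights of tool (T4)
  set u : ℕ → ℝ := fun j => if j = 0 then 0 else π (j - 1) with hu
  set g : ℕ → ℝ := fun j => x j / π j with hg
  have key := sum_mul_sum_le_of_mlr (t + 1) u π g
    (fun j k hj hkj => by
      rw [hu]; dsimp only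
      rcases Nat.eq_zero_or_pos k with rfl | hk
      · rw [if_pos rfl, zero_mul]; exact mul_nonneg (by split_ifs; exact le_rfl; exact hπnn _) (hπnn 0)
      · rw [if_neg (by omega), if_neg (by omega)]
        have h := real_layer_logConcave p F (a := k - 1) (b := j - 1) (by omega)
        have e1 : k - 1 + 1 = k := by omega
        have e2 : j - 1 + 1 = j := by omega
        rw [e1, e2] at h
        exact h.trans (le_of_eq (mul_comm _ _)))
    (fun j k hj hkj => by
      rw [hg]; dsimp only
      rw [div_le_div_iff₀ (hπpos k (by omega)) (hπpos j (by omega))]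
      exact hMx j k hkj)
  -- identify the four sums
  have e1 : ∑ j ∈ range (t + 1), π j * g j = ∑ j ∈ range (t + 1), x j := by
    refine Finset.sum_congr rfl fun j hj => ?_
    rw [Finset.mem_range] at hj
    rw [hg]; dsimp only
    rw [mul_div_cancel₀ _ (hπpos j (by omega)).ne']
  have e2 : ∑ k ∈ range (t + 1), u k = ∑ k ∈ range t, π k := by
    rw [Finset.sum_range_succ']
    rw [hu]; dsimp only
    rw [if_pos rfl, add_zero]
    exact Finset.sum_congr rfl fun k _ => by rw [if_neg (Nat.succ_ne_zero k), Nat.add_sub_cancel]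
  have e3 : ∑ j ∈ range (t + 1), u j * g j ≤ ∑ j ∈ range t, y j := by
    rw [Finset.sum_range_succ']
    rw [hu, hg]; dsimp only
    rw [if_pos rfl, zero_mul, add_zero]
    refine Finset.sum_le_sum fun k hk => ?_
    rw [Finset.mem_range] at hk
    rw [if_neg (Nat.succ_ne_zero k), Nat.add_sub_cancel, mul_div_assoc', div_le_iff₀ (hπpos (k + 1) (by omega))]
    rw [mul_comm (π k) (x (k + 1))]
    exact hS k
  rw [e1, e2] at key
  have hΛ : 0 ≤ ∑ k ∈ range (t + 1), π k := Finset.sum_nonneg fun k _ => hπnn k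
  have h4 : (∑ j ∈ range (t + 1), u j * g j) * (∑ k ∈ range (t + 1), π k) ≤ (∑ j ∈ range t, y j) * (∑ k ∈ range (t + 1), π k) :=
    mul_le_mul_of_nonneg_right e3 hΛ
  nlinarith [key, h4]

end SahiOneStep

end Summit.CriticalPhenomena.PercolationContinuityZ3.Theorems
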